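import Summits.Ventures.CertifiedManyBodySolver.Theorems.CovHg1201M19P10KinematicPartsTp
import Summits.Ventures.CertifiedManyBodySolver.Downfold.BoxesHg1201ESlantCutSlots
import HarnessLib

/-!
# Theorems/CovHg1201M19P10SlantParts.lean — route «CovHg1201M19P10» (Hg-1201 @ 10 GPa): after «SLANT-CUT» the certificate part of BOTH cruxes is the
# upper-left TRIANGLE `{σ ∈ [−49/100, −12/25], n ∈ [43/50, 22/25], n ≥ 43/50 + 2(σ + 49/100)}` — HALF of the outer strip

Supports stmt-Ventures-27105 «PatchBottomP10» (and stmt-Ventures-27104 «PatchLeftEdgeP10»). Ingredients: hubbard-cov-hg1201-box-2 g1's outer-strip reductions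
(`Theorems/CovHg1201M19P10KinematicPartsTp.lean`, p628951: item ⇐ item on `σ ∈ [−49/100, −12/25] × n ∈ [43/50, 22/25]`) and this seat's state-free words UNDER
THE CHORD between the @10 N-KINCUT corner `(−49/100, 43/50)` and the TP-KINCUT corner `(−12/25, 22/25)` (`Downfold/BoxesHg1201ESlantCutSlots.lean`:
`hg1201M19P10_patchBottomP10_slantSlots_kinematic`, `hg1201M19P10_patchLeftEdgeP10_slantSlots_kinematic`; generic chord transport
`Observables/StiffnessHalfBathtubSlant.lean`, p629801 — the two `M = 512` rows of record joined by joint convexity, zero new kernel row).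
* `covHg1201M19P10_PatchBottomP10_of_outerTriangle` / `covHg1201M19P10_PatchLeftEdgeP10_of_outerTriangle`: (item restricted to the TRIANGLE) → item.
* `covHg1201M19P10_cruxes_of_outerTriangles`: both at once.
HONEST FRAMING: set algebra + one-body kinematics + the torus-limit variational inequality; zero solve, no claim node, no definition; CONDITIONAL on the triangle, where the
certificates (A″3 hub / built spoke / pins, captain hubbard-cov-hg1201-plan-1) are still owed; certified stiffness-scale CEILINGS on a downfolded screening-grade PRESSURE box
= CONTROL / CALIBRATION + labelled heuristic (xx1; content = below `0.98 ×` the kinematic MAJORANT, no suppression below free claimed; screening-grade pressure frame, no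
`dT_c/dP` sentence); a ceiling never speaks to the presence of superconductivity; NO item, stub or rung leaf is closed by this file; no summit statement is proved.
Seat hubbard-cov-hg1201-unc-2 g3 (`prover-hubbard-cov-hg1201-unc-2-g2-0`), cell `pub/hubbard-downfold`.
-/

noncomputable section

namespace Summit.Ventures.CertifiedManyBodySolver.Theorems

open Set Filter Topology
open Summit.Ventures.CertifiedManyBodySolver.Theses.CovHg1201M19P10
open Summit.Ventures.CertifiedManyBodySolver.Observables
open Summit.Ventures.CertifiedManyBodySolver.Downfold
open Summit.Ventures.CertifiedManyBodySolver
open Literature.MathematicalPhysics.QuantumLattice Literature.MathematicalPhysics.QuantumLattice.ThermodynamicLimit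
open Literature.Probability.LatticeModels
open Matrix HubbardWave0
open scoped BigOperators ComplexOrder

/-- **«PatchBottomP10» (stmt-Ventures-27105) from its OUTER TRIANGLE**: the item restricted to slots `σ ∈ [−49/100, −12/25]` (sources `s ∈ [−49/100, σ]`) and densities
`n ∈ [43/50, 22/25]` with `n ≥ 43/50 + 2(σ + 49/100)` implies the item — densities `≤ 43/50`, slots `≥ −12/25` and the trapezoid under the chord are state-free.
CONDITIONAL on the triangle. [cite: ScalapinoWhiteZhang1993, §II] [cite: LiebLoss1993, §8, Theorem 8.2] -/
theorem covHg1201M19P10_PatchBottomP10_of_outerTriangle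
    (h : ∀ n ∈ Set.Icc (43 / 50 : ℝ) (22 / 25), ∀ σ ∈ Set.Icc (-49 / 100 : ℝ) (-12 / 25), 43 / 50 + 2 * (σ + 49 / 100) ≤ n →
      ∀ s ∈ Set.Icc (-49 / 100 : ℝ) σ,
      ∀ (ω : InfVolFermionState 2) (Ls : ℕ → ℕ) (ψ : ∀ L, Fock (Orb (FermionTorus 2 L))),
      Tendsto Ls atTop atTop →
      (∀ j, IsGroundStateInSector (hubbardTorusTT' (Ls j) 1 s 3) (rectN n (Ls j)) 0 (ψ (Ls j))) →
      (∀ j, star (ψ (Ls j)) ⬝ᵥ ψ (Ls j) = 1) → ω.IsTorusLimitOf ψ Ls →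
      -(4767609 / 10000000 : ℝ) ≤ ((Finset.univ : Finset (DihedralGroup 4)).card : ℝ)⁻¹ * ∑ g ∈ (Finset.univ : Finset (DihedralGroup 4)),
        (ω.expect (d4ShiftSet g 0 (Literature.Probability.LatticeModels.box 2 7))
          (fermionEmbed (PolySite.d4Emb g 0 (Literature.Probability.LatticeModels.box 2 7)) (-oddMomentObsTT σ 3 0))).re) :
    PatchBottomP10 := by
  refine covHg1201M19P10_PatchBottomP10_of_outerStrip (fun n hn σ hσ s hs ω Ls ψ hLs hψ h1 hω => ?_)
  rcases le_or_gt n (43 / 50 + 2 * (σ + 49 / 100)) with hle | hgt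
  · exact hg1201M19P10_patchBottomP10_slantSlots_kinematic n ⟨le_trans (by norm_num) hn.1, hn.2⟩ σ hσ hle s hs ω Ls ψ hLs hψ h1 hω
  · exact h n hn σ hσ hgt.le s hs ω Ls ψ hLs hψ h1 hω

/-- **«PatchLeftEdgeP10» (stmt-Ventures-27104) from its OUTER TRIANGLE**: the item restricted to `σ ∈ [−49/100, −12/25]`, `n ∈ [43/50, 22/25]`,
`n ≥ 43/50 + 2(σ + 49/100)` (states at `(−49/100, U′, n)`, `U′ ∈ [3, 17/2]`) implies the item. CONDITIONAL on the triangle.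
[cite: ScalapinoWhiteZhang1993, §II] [cite: LiebLoss1993, §8, Theorem 8.2] -/
theorem covHg1201M19P10_PatchLeftEdgeP10_of_outerTriangle
    (h : ∀ n ∈ Set.Icc (43 / 50 : ℝ) (22 / 25), ∀ σ ∈ Set.Icc (-49 / 100 : ℝ) (-12 / 25), 43 / 50 + 2 * (σ + 49 / 100) ≤ n →
      ∀ U' ∈ Set.Icc (3 : ℝ) (17 / 2),
      ∀ (ω : InfVolFermionState 2) (Ls : ℕ → ℕ) (ψ : ∀ L, Fock (Orb (FermionTorus 2 L))),
      Tendsto Ls atTop atTop →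
      (∀ j, IsGroundStateInSector (hubbardTorusTT' (Ls j) 1 (-49 / 100) U') (rectN n (Ls j)) 0 (ψ (Ls j))) →
      (∀ j, star (ψ (Ls j)) ⬝ᵥ ψ (Ls j) = 1) → ω.IsTorusLimitOf ψ Ls →
      -(4767609 / 10000000 : ℝ) ≤ ((Finset.univ : Finset (DihedralGroup 4)).card : ℝ)⁻¹ * ∑ g ∈ (Finset.univ : Finset (DihedralGroup 4)),
        (ω.expect (d4ShiftSet g 0 (Literature.Probability.LatticeModels.box 2 7))
          (fermionEmbed (PolySite.d4Emb g 0 (Literature.Probability.LatticeModels.box 2 7)) (-oddMomentObsTT σ U' 0))).re) :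
    PatchLeftEdgeP10 := by
  refine covHg1201M19P10_PatchLeftEdgeP10_of_outerStrip (fun n hn σ hσ U' hU' ω Ls ψ hLs hψ h1 hω => ?_)
  rcases le_or_gt n (43 / 50 + 2 * (σ + 49 / 100)) with hle | hgt
  · exact hg1201M19P10_patchLeftEdgeP10_slantSlots_kinematic n ⟨le_trans (by norm_num) hn.1, hn.2⟩ σ hσ hle U' hU' ω Ls ψ hLs hψ h1 hω
  · exact h n hn σ hσ hgt.le U' hU' ω Ls ψ hLs hψ h1 hω

/-- **Both cruxes of «CovHg1201M19P10» from their OUTER TRIANGLES at once** (`1/112` of the typed P10 box each). [cite: ScalapinoWhiteZhang1993, §II] -/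
theorem covHg1201M19P10_cruxes_of_outerTriangles
    (hB : ∀ n ∈ Set.Icc (43 / 50 : ℝ) (22 / 25), ∀ σ ∈ Set.Icc (-49 / 100 : ℝ) (-12 / 25), 43 / 50 + 2 * (σ + 49 / 100) ≤ n →
      ∀ s ∈ Set.Icc (-49 / 100 : ℝ) σ,
      ∀ (ω : InfVolFermionState 2) (Ls : ℕ → ℕ) (ψ : ∀ L, Fock (Orb (FermionTorus 2 L))),
      Tendsto Ls atTop atTop →
      (∀ j, IsGroundStateInSector (hubbardTorusTT' (Ls j) 1 s 3) (rectN n (Ls j)) 0 (ψ (Ls j))) →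
      (∀ j, star (ψ (Ls j)) ⬝ᵥ ψ (Ls j) = 1) → ω.IsTorusLimitOf ψ Ls →
      -(4767609 / 10000000 : ℝ) ≤ ((Finset.univ : Finset (DihedralGroup 4)).card : ℝ)⁻¹ * ∑ g ∈ (Finset.univ : Finset (DihedralGroup 4)),
        (ω.expect (d4ShiftSet g 0 (Literature.Probability.LatticeModels.box 2 7))
          (fermionEmbed (PolySite.d4Emb g 0 (Literature.Probability.LatticeModels.box 2 7)) (-oddMomentObsTT σ 3 0))).re)
    (hL : ∀ n ∈ Set.Icc (43 / 50 : ℝ) (22 / 25), ∀ σ ∈ Set.Icc (-49 / 100 : ℝ) (-12 / 25), 43 / 50 + 2 * (σ + 49 / 100) ≤ n →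
      ∀ U' ∈ Set.Icc (3 : ℝ) (17 / 2),
      ∀ (ω : InfVolFermionState 2) (Ls : ℕ → ℕ) (ψ : ∀ L, Fock (Orb (FermionTorus 2 L))),
      Tendsto Ls atTop atTop →
      (∀ j, IsGroundStateInSector (hubbardTorusTT' (Ls j) 1 (-49 / 100) U') (rectN n (Ls j)) 0 (ψ (Ls j))) →
      (∀ j, star (ψ (Ls j)) ⬝ᵥ ψ (Ls j) = 1) → ω.IsTorusLimitOf ψ Ls →
      -(4767609 / 10000000 : ℝ) ≤ ((Finset.univ : Finset (DihedralGroup 4)).card : ℝ)⁻¹ * ∑ g ∈ (Finset.univ : Finset (DihedralGroup 4)),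
        (ω.expect (d4ShiftSet g 0 (Literature.Probability.LatticeModels.box 2 7))
          (fermionEmbed (PolySite.d4Emb g 0 (Literature.Probability.LatticeModels.box 2 7)) (-oddMomentObsTT σ U' 0))).re) :
    PatchBottomP10 ∧ PatchLeftEdgeP10 :=
  ⟨covHg1201M19P10_PatchBottomP10_of_outerTriangle hB, covHg1201M19P10_PatchLeftEdgeP10_of_outerTriangle hL⟩

end Summit.Ventures.CertifiedManyBodySolver.Theorems

end
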